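import Literature.NumberTheory.LFunctions.WeilExplicit
import Literature.NumberTheory.LFunctions.WeilMarkovQuadratic
import HarnessLib

/-!
# `SignCone.SignConeFarField`, line `Sketch` — stub `stub_bombieriReal` (item stmt-RiemannHypothesis-16305)

Bombieri's form of the archimedean-plus-polar part of Weil's functional, REAL PART, as one absolutely
convergent integral over `(0, ∞)`: for a Weil test `F`, with `A = Re F(0)`, `s(x) = Re F(x) + Re F(−x)`,

`Re (weilPolarTerm F + weilArchTerm F) = ∫₀^∞ [s(x)(e^{-x/2} + e^{x/2}) − (e^{x/2}s(x) − 2A)/(2 sinh x)] dx − (log 4π + γ)·A`,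

and the real integrand is integrable on `(0, ∞)`. Ingredients (all proved in the tree):
`integral_Ioi_add_comp_neg_mul_polarWeight` (`ĝ(0) + ĝ(1) = ∫₀^∞ (g(x)+g(−x))(e^{-x/2}+e^{x/2}) dx`),
`weilArchTermBombieri_eq_weilArchTerm_holds` (Bombieri 2000, (2.8)), `integrableOn_bombieriIntegrand`,
and `integral_re` (real parts under the integral sign).
-/

noncomputable section

-- `Summit.RiemannHypothesis.RiemannHypothesis.…` repeats a namespace component by design (D-0017 layout).
set_option linter.dupNamespace false

open scoped ComplexConjugate
open Complex MeasureTheory Set Filter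

namespace Summit.RiemannHypothesis.RiemannHypothesis.Theorems.SignConeFarField

open Literature.NumberTheory.LFunctions

/-- The polar weight is real: `e^{-x/2} + e^{x/2}` as a complex number. -/
theorem polarWeight_ofReal (x : ℝ) :
    cexp (-(x : ℂ) / 2) + cexp ((x : ℂ) / 2) = ((Real.exp (-(x / 2)) + Real.exp (x / 2) : ℝ) : ℂ) := by
  push_cast
  ring_nf

/-- Real part of the polar integrand `(F(x) + F(−x))(e^{-x/2} + e^{x/2})`. -/
theorem re_polarIntegrand (F : ℝ → ℂ) (x : ℝ) :
    ((F x + F (-x)) * (cexp (-(x : ℂ) / 2) + cexp ((x : ℂ) / 2))).re =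
      ((F x).re + (F (-x)).re) * (Real.exp (-(x / 2)) + Real.exp (x / 2)) := by
  rw [polarWeight_ofReal, Complex.re_mul_ofReal, Complex.add_re]

/-- Real part of Bombieri's integrand `(e^{x/2}(F(x) + F(−x)) − 2F(0))/(2 sinh x)`. -/
theorem re_bombieriIntegrand (F : ℝ → ℂ) (x : ℝ) :
    (((Real.exp (x / 2) : ℂ) * (F x + F (-x)) - 2 * F 0) / (2 * Real.sinh x : ℂ)).re =
      (Real.exp (x / 2) * ((F x).re + (F (-x)).re) - 2 * (F 0).re) / (2 * Real.sinh x) := by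
  have hden : (2 * Real.sinh x : ℂ) = ((2 * Real.sinh x : ℝ) : ℂ) := by push_cast; rfl
  rw [hden, Complex.div_ofReal_re, Complex.sub_re, Complex.re_ofReal_mul, Complex.add_re]
  congr 2
  simp [Complex.mul_re]

/-- **Stub `stub_bombieriReal` (Bombieri form, real part).** For a Weil test `F`, with `A = Re F(0)` and
`s(x) = Re F(x) + Re F(−x)`: the real integrand
`h(x) = s(x)(e^{-x/2} + e^{x/2}) − (e^{x/2} s(x) − 2A)/(2 sinh x)` is integrable on `(0, ∞)` and
`Re(weilPolarTerm F + weilArchTerm F) = ∫₀^∞ h − (log 4π + γ) A`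
(`integral_Ioi_add_comp_neg_mul_polarWeight`, `weilArchTermBombieri_eq_weilArchTerm_holds`,
`integrableOn_bombieriIntegrand`, real parts under the integral sign). -/
theorem stub_bombieriReal : ∀ F : ℝ → ℂ, IsWeilTest F →
    IntegrableOn (fun x : ℝ => ((F x).re + (F (-x)).re) * (Real.exp (-(x / 2)) + Real.exp (x / 2)) -
        (Real.exp (x / 2) * ((F x).re + (F (-x)).re) - 2 * (F 0).re) / (2 * Real.sinh x)) (Set.Ioi 0) ∧
      (weilPolarTerm F + weilArchTerm F).re =
        (∫ x in Set.Ioi (0 : ℝ), (((F x).re + (F (-x)).re) * (Real.exp (-(x / 2)) + Real.exp (x / 2)) -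
          (Real.exp (x / 2) * ((F x).re + (F (-x)).re) - 2 * (F 0).re) / (2 * Real.sinh x))) -
        (Real.log (4 * Real.pi) + Real.eulerMascheroniConstant) * (F 0).re := by
  intro F hF
  have hk : IsWeilTest (weilSymm F) := hF.weilSymm
  -- the two complex integrands
  set P : ℝ → ℂ := fun x => (F x + F (-x)) * (cexp (-(x : ℂ) / 2) + cexp ((x : ℂ) / 2)) with hP
  set B : ℝ → ℂ := fun x => ((Real.exp (x / 2) : ℂ) * (F x + F (-x)) - 2 * F 0) / (2 * Real.sinh x : ℂ)
    with hB
  have hPint : Integrable P := by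
    have h : Integrable (fun x : ℝ => weilSymm F x * (cexp (-(x : ℂ) / 2) + cexp ((x : ℂ) / 2))) :=
      (hk.1.continuous.mul (by fun_prop : Continuous fun x : ℝ =>
        cexp (-(x : ℂ) / 2) + cexp ((x : ℂ) / 2))).integrable_of_hasCompactSupport hk.2.mul_right
    simpa [weilSymm] using h
  have hPint' : IntegrableOn P (Ioi 0) := hPint.integrableOn
  have hBint : IntegrableOn B (Ioi 0) := integrableOn_bombieriIntegrand hF
  -- the real integrand is `Re (P - B)`
  have hre_eq : (fun x : ℝ => ((F x).re + (F (-x)).re) * (Real.exp (-(x / 2)) + Real.exp (x / 2)) -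
      (Real.exp (x / 2) * ((F x).re + (F (-x)).re) - 2 * (F 0).re) / (2 * Real.sinh x)) =
      fun x : ℝ => RCLike.re (P x - B x) := by
    funext x
    rw [RCLike.re_to_complex, Complex.sub_re, hP, hB]
    dsimp only
    rw [re_polarIntegrand, re_bombieriIntegrand]
  refine ⟨?_, ?_⟩
  · rw [hre_eq]
    exact (hPint'.sub hBint).re
  · have hpolar : weilPolarTerm F = ∫ x in Ioi (0 : ℝ), P x :=
      (integral_Ioi_add_comp_neg_mul_polarWeight hF).symm
    have harch : weilArchTerm F =
        -(Real.log (4 * Real.pi) + Real.eulerMascheroniConstant : ℂ) * F 0 - ∫ x in Ioi (0 : ℝ), B x := by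
      rw [← weilArchTermBombieri_eq_weilArchTerm_holds hF, weilArchTermBombieri_eq]
    have hsub : Integrable (fun x : ℝ => P x - B x) (volume.restrict (Ioi 0)) := hPint'.sub hBint
    rw [hpolar, harch, hre_eq, integral_re hsub, integral_sub hPint' hBint]
    simp [Complex.mul_re, Complex.sub_re, Complex.add_re]
    ring

end Summit.RiemannHypothesis.RiemannHypothesis.Theorems.SignConeFarField

end
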